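import Summits.Langlands.Langlands.Theses.EisensteinDegreeShift
import Summits.Langlands.Langlands.Theorems.EisensteinDegreeShiftSectorComplementStubAvatarConjugacy
import Literature.FieldTheory.AlgClosed.PadicAlgClEquivComplex
import HarnessLib

/-!
# Birth skeleton (BC3) for crux stmt-Langlands-18372
`Summit.Langlands.Langlands.Theses.EisensteinDegreeShift.SectorComplement` — line `birth_EisensteinDegreeShift`

Registered by the skeleton-registrar seat `skel-stmt-Langlands-18372` (planner one-shot, route re-audit bin HONEST),
2026-08-17.  File name: the crux directory `Cruxes/SectorComplement/` is SHARED by the homonymous junction items of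
many routes (`Lines/birth.lean` is stmt-Langlands-14623's registered skeleton, HolomorphicShadow); following the
`birth_<Route>` convention of the directory this line is published as `Lines/birth_EisensteinDegreeShift.lean`,
namespace `Summit.Langlands.Langlands.Cruxes.SectorComplement.BirthEisensteinDegreeShift`.

Route `route-Langlands-EisensteinDegreeShift` (rev 0; deciding theorem `closes : EisensteinSteinbergSeed →
EisensteinSeededLifting → SolubleDescentGLn → SectorComplement → Langlands`).  The crux is the route's declared
RESIDUAL junction (rank 9, difficulty open-problem, "never staffed from this route"):

  `SectorComplement := BorelFLReciprocity → _root_.Langlands`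

where the route TARGET `BorelFLReciprocity` (stmt-Langlands-18368) is clause (B) of the summit in Satake form ON
THE BOREL–FONTAINE–LAFFAILLE SECTOR: `K` CM, `2 ≤ n < p`, `p` unramified in `K`, `ρ : Γ_K → GL_n(ℚ̄_p)` irreducible,
unramified a.e., with a residually upper-triangular integral model, crystalline above `p` for Fontaine's pinned datum
with `n` distinct labelled Hodge–Tate weights in an interval of length `≤ p − 2` ⟹ `ρ` is Satake–Frobenius
compatible a.e. with an L-algebraic cuspidal `π` of `GL_n(𝔸_K)`.  Refuter rattack-18372 (kernel-checked,
`Rattack_EisensteinDegreeShift.lean`): `Langlands ↔ BorelFLReciprocity ∧ SectorComplement`, `¬SectorComplement ↔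
BorelFLReciprocity ∧ ¬Langlands` — honest residual, conjecture-grade.

## The skeleton: the tree's typed partition of `GL_n` reciprocity, with the Borel–FL sector granted

The served summit is `Langlands := ∀ F, Nonempty (ReciprocityData F) ∧ ∀ 𝓡 n, 0 < n → ∀ hcpt, (A) ∧ (B)` (re-type
p141787).  Its one certified typed partition in the tree is route PrimeSwitchSplit (rev 4, deciding theorem OK, READY):
`B_w → W⁺ → P → L∤R → RD → U → Langlands`, glued by reading each place above `ℓ` through a prime `ℓ' ∈ {2, 3}`
below it.  Exactly as the crux-strategist of the sibling junction `DyadicOddResidue.SectorComplement`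
(stmt-Langlands-18745, `Lines/DyadicOddResidueSectorComplementOfLeaves.lean`, rc 0, 0 sorry) did for its target,
this skeleton EXCISES the route target from the (B)-leaf, so that the crux's hypothesis is CONSUMED, not discarded:

* `stub_weakAutomorphyFromBorelFL` — X ⇒ B_w: granted `BorelFLReciprocity`, Fontaine–Mazur–Langlands in the a.e.
  Satake form for EVERY number field `K`, every `n ≥ 1` and every irreducible pinned-geometric `ρ` (the text of
  `PrimeSwitchSplit.WeakGeometricAutomorphy`, stmt-Langlands-17414, behind the antecedent `BorelFLReciprocity` BY NAME);
  i.e. B_w OFF the Borel–FL sector (residually non-triangulable `ρ̄`, non-FL or irregular weights, `p` ramified or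
  `≤ n`, non-CM `K`, merely de Rham `ρ`) — the open core, implied outright by B_w;
* `stub_satakeAvatarExistence`    — W⁺,  VERBATIM the text of `PrimeSwitchSplit.SatakeAvatarExistence` (stmt-Langlands-17415);
* `stub_padicMemberCompatibility`  — P,   VERBATIM `PrimeSwitchSplit.PadicMemberCompatibility` (stmt-Langlands-17534);
* `stub_compatibilityAwayFromLR`   — L∤R, VERBATIM `PrimeSwitchSplit.CompatibilityAwayFromLR` (stmt-Langlands-18084);
* `stub_canonicalReciprocityData`  — RD,  VERBATIM `PrimeSwitchSplit.CanonicalReciprocityData` (stmt-Langlands-17930);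
* `stub_avatarConjugacy`           — U,   VERBATIM `PrimeSwitchSplit.AvatarConjugacy` (stmt-Langlands-17844, provable-now
  from the landed `isConjugate_of_satakeFrobCompatibleAt` p119850, kept a stub for the import-hygiene reason recorded
  on that item: the landed file's module cone).

Texts were extracted programmatically from `Theses/PrimeSwitchSplit.lean` rev 4 (no PrimeSwitchSplit import here, so
that a rewrite of that route file cannot break this one; verbatim-ness certified separately in the seat folder by
`Iff.rfl` against the PrimeSwitchSplit decls, `bc/verbatim_check.lean`, rc 0).  The composition `SectorComplement_of`
is KERNEL-CHECKED (no `sorry`): `intro hX`; `hB := hXB hX` (X consumed); `Nonempty (ReciprocityData F)` from RD; then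
for EVERY datum `Rec` the PrimeSwitchSplit glue verbatim — every finite place misses `2` or `3`; the local–global
helper (Rec-geometric by P(i); compatible at `v ∤ ℓ` by L∤R, at `v ∣ ℓ` by W⁺ at `ℓ'`, L∤R at `(ℓ', v)`, P(ii));
(A) = W⁺ + helper + U; (B) = hB + helper.  Hypotheses = the six stub statements by name (`_Goal.stub_*` mirrors,
registered-skeleton shape); conclusion = the route decl `SectorComplement` BY NAME.

No stub is the crux and no stub is the summit (BC3 probes, seat folder `bc/stubprobe_*.lean`: `stub → SectorComplement`
and `stub → _root_.Langlands` by `first | exact? | simpa | aesop` FAIL for all six stubs).  Sorries at registration: exactly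
six, one per `stub_*`, none elsewhere.

## Lead's log (line lead prover-line-stmt-Langlands-18372-0, cycle 1, 2026-08-17)

* Stub 6 `stub_avatarConjugacy` LANDED: `Theorems/EisensteinDegreeShiftSectorComplementStubAvatarConjugacy.lean`
  (p172889, commit 803ac996c473; decl `Summit.Langlands.Langlands.Theorems.EisensteinDegreeShiftSectorComplement.stub_avatarConjugacy`,
  std axioms) — its `sorry` below is replaced by that theorem (imported).  Sorries now: FIVE (stubs 1–5).
* Stubs 1–5 are NOT delegated: stub 1 is `X → B_w` (B_w = `PrimeSwitchSplit.WeakGeometricAutomorphy`, stmt-17414,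
  `(stub₁ → B_w) ↔ X`), stubs 2–5 are verbatim the OPEN items 17415 / 17534 / 18084 / 17930 of route PrimeSwitchSplit, each
  summit-scale and summit-implied (Disproof.lean PART IV §E6: `Langlands ↔ X ∧ stub₁ ∧ … ∧ stub₆`); they close when those items do.
-/

noncomputable section

set_option linter.dupNamespace false -- project-wide; `Summit.Langlands.Langlands` is the mandated namespace

namespace Summit.Langlands.Langlands.Cruxes.SectorComplement.BirthEisensteinDegreeShift

open scoped NumberField Classical Topology
open Filter IsDedekindDomain
open Literature.NumberTheory.Automorphic Literature.NumberTheory.GaloisRepresentations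
open Summit.Langlands

open Summit.Langlands.Langlands.Theses.EisensteinDegreeShift (BorelFLReciprocity SectorComplement)

/-! ## 0. The crux, by name -/

/-- The crux IS `BorelFLReciprocity → Langlands`, definitionally. [folklore] -/
theorem sectorComplement_iff : SectorComplement ↔ (BorelFLReciprocity → _root_.Langlands) :=
  Iff.rfl

/-! ## 1. The six stubs (the ONLY sorries of this file) -/

/-- **stub X ⇒ B_w — Fontaine–Mazur–Langlands (a.e. Satake form, every `K`, every `n ≥ 1`) GRANTED the Borel–FL sector.**
The consequent is VERBATIM the text of `PrimeSwitchSplit.WeakGeometricAutomorphy` (stmt-Langlands-17414): every irreducible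
`ρ : Γ_K → GL_n(ℚ̄_ℓ)` unramified a.e. and de Rham above `ℓ` for Fontaine's pinned datum is Satake–Frobenius compatible a.e.
with some L-algebraic cuspidal `π`.  Content = B_w OFF the route's sector (the antecedent discharges exactly the residually
Borel, Fontaine–Laffaille-crystalline, CM, `2 ≤ n < p`, `p`-unramified slice); OPEN (automorphy lifting exists only in regular,
residually adequate, CM / totally-real regimes: TW coincidence, NonRegularWeight, ResiduallyReducible, ShimuraVarietyRealization
barriers).  Why it might fail: only with Fontaine–Mazur itself.  This is the stub that USES the crux's hypothesis.
[cite: FontaineMazurGeometric1995, Conj. 1] [cite: BuzzardGeeLMS2014, Conj. 3.2.2] -/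
theorem stub_weakAutomorphyFromBorelFL :
    BorelFLReciprocity → ∀ (K : Type) [Field K] [NumberField K] (n : ℕ) (hcpt : Literature.NumberTheory.Automorphic.isCompact_glFiniteIntegralLevel n K), 0 < n → ∀ (ℓ : ℕ) [Fact ℓ.Prime] (ι : PadicAlgCl ℓ ≃+* ℂ) (ρ : Literature.NumberTheory.GaloisRepresentations.FramedGaloisRep K (PadicAlgCl ℓ) n), ρ.toGaloisRep.IsIrreducible → ((∀ᶠ v : IsDedekindDomain.HeightOneSpectrum (NumberField.RingOfIntegers K) in cofinite, ρ.IsUnramifiedAt v) ∧ ∀ (v : IsDedekindDomain.HeightOneSpectrum (NumberField.RingOfIntegers K)) (hv : ((ℓ : ℕ) : NumberField.RingOfIntegers K) ∈ v.asIdeal), (Literature.NumberTheory.PAdicHodge.fontainePstAdicCompletion v ℓ hv).IsDeRhamFramed (ρ.toLocal v)) → ∃ π : Literature.NumberTheory.Automorphic.CuspidalAutomorphicRepData n K hcpt, π.1.IsLAlgebraic ∧ ∀ᶠ v : IsDedekindDomain.HeightOneSpectrum (NumberField.RingOfIntegers K) in cofinite, SatakeFrobCompatibleAt ι π.1 ρ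 v := by
  sorry

/-- **stub W⁺ — irreducible Satake avatar of every L-algebraic cuspidal `π`** (VERBATIM `PrimeSwitchSplit.SatakeAvatarExistence`,
stmt-Langlands-17415): Buzzard–Gee Conj. 3.2.2 weak form + cuspidal ⇒ irreducible.  OPEN beyond regular `π` over CM / totally real
`K` (HLTT 2016, Scholze 2015) and open for irreducibility in rank `≥ 3` outside polarized / density-one cases.
[cite: BuzzardGeeLMS2014, Conj. 3.2.2] [cite: HarrisLanTaylorThorneRMS2016, Thm. A] -/
theorem stub_satakeAvatarExistence :
    ∀ (K : Type) [Field K] [NumberField K] (n : ℕ) (hcpt : Literature.NumberTheory.Automorphic.isCompact_glFiniteIntegralLevel n K), 0 < n → ∀ (π : Literature.NumberTheory.Automorphic.CuspidalAutomorphicRepData n K hcpt), π.1.IsLAlgebraic → ∀ (ℓ : ℕ) [Fact ℓ.Prime] (ι : PadicAlgCl ℓ ≃+* ℂ), ∃ ρ : Literature.NumberTheory.GaloisRepresentations.FramedGaloisRep K (PadicAlgCl ℓ) n, ρ.toGaloisRep.IsIrreducible ∧ ∀ᶠ v : IsDedekindDomain.HeightOneSpectrum (NumberField.RingOfIntegers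 K) in cofinite, SatakeFrobCompatibleAt ι π.1 ρ v := by
  sorry

/-- **stub P — the p-adic member: de Rham above `ℓ` and the prime-switch principle** (VERBATIM `PrimeSwitchSplit.PadicMemberCompatibility`,
stmt-Langlands-17534): Fontaine's `C_WD` for the compatible system of `π` (Saito; Caraiani 2012/2014; AHTW 2026 Thm. 1.2.1 up to
semisimplification for regular `π` over CM).  [cite: FontaineAsterisque223VIII, §2.3.7] [cite: Caraiani2014, Thm. 1.1] -/
theorem stub_padicMemberCompatibility :
    ∀ (K : Type) [Field K] [NumberField K] (n : ℕ) (hcpt : Literature.NumberTheory.Automorphic.isCompact_glFiniteIntegralLevel n K), 0 < n → ∀ (π : Literature.NumberTheory.Automorphic.CuspidalAutomorphicRepData n K hcpt), π.1.IsLAlgebraic → ∀ (ℓ : ℕ) [Fact ℓ.Prime] (ι : PadicAlgCl ℓ ≃+* ℂ) (ρ : Literature.NumberTheory.GaloisRepresentations.FramedGaloisRep K (PadicAlgCl ℓ) n), ρ.toGaloisRep.IsIrreducible → (∀ᶠ v : IsDedekindDomain.HeightOneSpectrum (NumberField.RingOfIntegers K) in cofinite, SatakeFrobCompatibleAt ι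 π.1 ρ v) → ∀ (v : IsDedekindDomain.HeightOneSpectrum (NumberField.RingOfIntegers K)) (hv : ((ℓ : ℕ) : NumberField.RingOfIntegers K) ∈ v.asIdeal), (Literature.NumberTheory.PAdicHodge.fontainePstAdicCompletion v ℓ hv).IsDeRhamFramed (ρ.toLocal v) ∧ ∀ (Rec : ReciprocityData K) (ℓ' : ℕ) [Fact ℓ'.Prime] (ι' : PadicAlgCl ℓ' ≃+* ℂ) (ρ' : Literature.NumberTheory.GaloisRepresentations.FramedGaloisRep K (PadicAlgCl ℓ') n), ((ℓ' : ℕ) : NumberField.RingOfIntegers K) ∉ v.asIdeal → ρ'.toGaloisRep.IsIrreducible → (∀ᶠ w : IsDedekindDomain.HeightOneSpectrum (NumberField.RingOfIntegers K) in cofinite, SatakeFrobCompatibleAt ι' π.1 ρ' w) → LocalGlobalCompatibleAt Rec ι' π.1 ρ' v → LocalGlobalCompatibleAt Rec ι π.1 ρ v := by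
  sorry

/-- **stub L∤R — Taylor 2004 Conj. 7 at the places `v ∤ ℓ`, for EVERY reciprocity datum** (VERBATIM `PrimeSwitchSplit.CompatibilityAwayFromLR`,
stmt-Langlands-18084).  OPEN at ramified places beyond polarizable regular `π` (Varma 2024 up to F-ss and `N`); `∀ Rec` exposes
Henniart-sharpness of the typed `IsLocalLanglandsGL`.  [cite: TaylorGaloisRepresentations2004, Conj. 7] [cite: HarrisTaylorAMS2001, Thm. A] -/
theorem stub_compatibilityAwayFromLR :
    ∀ (K : Type) [Field K] [NumberField K] (Rec : ReciprocityData K) (n : ℕ) (hcpt : Literature.NumberTheory.Automorphic.isCompact_glFiniteIntegralLevel n K), 0 < n → ∀ (π : Literature.NumberTheory.Automorphic.CuspidalAutomorphicRepData n K hcpt), π.1.IsLAlgebraic → ∀ (ℓ : ℕ) [Fact ℓ.Prime] (ι : PadicAlgCl ℓ ≃+* ℂ) (ρ : Literature.NumberTheory.GaloisRepresentations.FramedGaloisRep K (PadicAlgCl ℓ) n), ρ.toGaloisRep.IsIrreducible → ((∀ᶠ v : IsDedekindDomain.HeightOneSpectrum (NumberField.RingOfIntegers K) in cofinite, ρ.IsUnramifiedAt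 v) ∧ ∀ (v : IsDedekindDomain.HeightOneSpectrum (NumberField.RingOfIntegers K)) (hv : ((ℓ : ℕ) : NumberField.RingOfIntegers K) ∈ v.asIdeal), (Literature.NumberTheory.PAdicHodge.fontainePstAdicCompletion v ℓ hv).IsDeRhamFramed (ρ.toLocal v)) → (∀ᶠ v : IsDedekindDomain.HeightOneSpectrum (NumberField.RingOfIntegers K) in cofinite, SatakeFrobCompatibleAt ι π.1 ρ v) → ∀ v : IsDedekindDomain.HeightOneSpectrum (NumberField.RingOfIntegers K), ((ℓ : ℕ) : NumberField.RingOfIntegers K) ∉ v.asIdeal → LocalGlobalCompatibleAt Rec ι π.1 ρ v := by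
  sorry

/-- **stub RD — the summit's non-vacuity conjunct** (VERBATIM `PrimeSwitchSplit.CanonicalReciprocityData`, stmt-Langlands-17930):
a local Langlands datum at every completion, normalised against THE canonical local Artin maps (Harris–Taylor Thm. A / Henniart;
in the tree a formalisation debt: `LocalLanglandsDatum.nonempty` + canonicity of its Artin pins).
[cite: HarrisTaylorAMS2001, Thm. A] [cite: HenniartInventiones2000, Thm. 1.2] -/
theorem stub_canonicalReciprocityData :
    ∀ (F : Type) [Field F] [NumberField F], Nonempty (Summit.Langlands.ReciprocityData F) := by
  sorry

/-- **stub U — uniqueness of the irreducible Satake avatar up to conjugacy** (VERBATIM `PrimeSwitchSplit.AvatarConjugacy`,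
stmt-Langlands-17844): Chebotarev + Brauer–Nesbitt (Deligne–Serre 1974 Lemme 3.2).  CLOSED (lead, cycle 1): the landed
`Theorems.EisensteinDegreeShiftSectorComplement.stub_avatarConjugacy` (p172889; one line from
`ReciprocityUpToIrreducibility.isConjugate_of_satakeFrobCompatibleAt`, p119850; a `--supports` file, so no `_holds` link and the
17844 cone guardrail is untouched).  [cite: DeligneSerreASENS1974, Lemme 3.2] -/
theorem stub_avatarConjugacy :
    ∀ (K : Type) [Field K] [NumberField K] (n : ℕ) (hcpt : Literature.NumberTheory.Automorphic.isCompact_glFiniteIntegralLevel n K) (π : Literature.NumberTheory.Automorphic.CuspidalAutomorphicRepData n K hcpt) (ℓ : ℕ) [Fact ℓ.Prime] (ι : PadicAlgCl ℓ ≃+* ℂ) (ρ₀ ρ : Literature.NumberTheory.GaloisRepresentations.FramedGaloisRep K (PadicAlgCl ℓ) n), ρ₀.toGaloisRep.IsIrreducible → (∀ᶠ v : IsDedekindDomain.HeightOneSpectrum (NumberField.RingOfIntegers K) in Filter.cofinite, Summit.Langlands.SatakeFrobCompatibleAt ι π.1 ρ₀ v) → (∀ᶠ v : IsDedekindDomain.HeightOneSpectrum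 (NumberField.RingOfIntegers K) in Filter.cofinite, Summit.Langlands.SatakeFrobCompatibleAt ι π.1 ρ v) → Summit.Langlands.IsConjugate ρ₀ ρ :=
  Summit.Langlands.Langlands.Theorems.EisensteinDegreeShiftSectorComplement.stub_avatarConjugacy

/-! ## 2. The stub statements as named propositions (hypotheses of the composition, admissible by stub name)

Each `_Goal.stub_x` is `type_of% @stub_x`: literally the stub's statement, no text duplicated, no `sorry` inherited. -/

namespace _Goal

/-- The statement of `stub_weakAutomorphyFromBorelFL` (literally its type). [folklore] -/
def stub_weakAutomorphyFromBorelFL : Prop :=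
  type_of% @Summit.Langlands.Langlands.Cruxes.SectorComplement.BirthEisensteinDegreeShift.stub_weakAutomorphyFromBorelFL

/-- The statement of `stub_satakeAvatarExistence` (literally its type). [folklore] -/
def stub_satakeAvatarExistence : Prop :=
  type_of% @Summit.Langlands.Langlands.Cruxes.SectorComplement.BirthEisensteinDegreeShift.stub_satakeAvatarExistence

/-- The statement of `stub_padicMemberCompatibility` (literally its type). [folklore] -/
def stub_padicMemberCompatibility : Prop :=
  type_of% @Summit.Langlands.Langlands.Cruxes.SectorComplement.BirthEisensteinDegreeShift.stub_padicMemberCompatibility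

/-- The statement of `stub_compatibilityAwayFromLR` (literally its type). [folklore] -/
def stub_compatibilityAwayFromLR : Prop :=
  type_of% @Summit.Langlands.Langlands.Cruxes.SectorComplement.BirthEisensteinDegreeShift.stub_compatibilityAwayFromLR

/-- The statement of `stub_canonicalReciprocityData` (literally its type). [folklore] -/
def stub_canonicalReciprocityData : Prop :=
  type_of% @Summit.Langlands.Langlands.Cruxes.SectorComplement.BirthEisensteinDegreeShift.stub_canonicalReciprocityData

-- (`_Goal.stub_avatarConjugacy` retired by the lead, cycle 1: stub 6 is a theorem now and is used directly inside
-- `SectorComplement_of`, so it is no longer a hypothesis of the composition.)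

end _Goal

/-! ## 3. The composition (kernel-checked, no `sorry`): X⇒B_w → W⁺ → P → L∤R → RD → SectorComplement (U landed) -/

/-- **`EisensteinDegreeShift.SectorComplement` from its six stubs.**  `BorelFLReciprocity` is CONSUMED (`hB := hXB hX` is
B_w); `Nonempty (ReciprocityData F)` from RD; then, for EVERY datum `Rec`, verbatim the PrimeSwitchSplit glue (rev 4): every
finite place misses `2` or `3`; the local–global helper (irreducible Satake-compatible pairs are `Rec`-geometric by P(i) and
compatible at every finite place — at `v ∤ ℓ` by L∤R, at `v ∣ ℓ` by W⁺ at `ℓ' ∈ {2,3}`, L∤R at `(ℓ', v)`, P(ii)); (A) = W⁺ +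
helper + U; (B) = B_w + helper.  Hypotheses = the five OPEN stub statements by name (stub 6, U, is a landed theorem and is
invoked inside); conclusion = the route decl by name.
[cite: BuzzardGeeLMS2014, Conj. 3.2.1 and Conj. 3.2.2] [cite: FontaineMazurGeometric1995, Conj. 1]
[cite: TaylorGaloisRepresentations2004, Conj. 7] [cite: DeligneSerreASENS1974, Lemme 3.2] -/
theorem SectorComplement_of (hXB : _Goal.stub_weakAutomorphyFromBorelFL) (hW : _Goal.stub_satakeAvatarExistence)
    (hP : _Goal.stub_padicMemberCompatibility) (hA : _Goal.stub_compatibilityAwayFromLR)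
    (hRD : _Goal.stub_canonicalReciprocityData) : SectorComplement := by
  dsimp only [_Goal.stub_weakAutomorphyFromBorelFL, _Goal.stub_satakeAvatarExistence, _Goal.stub_padicMemberCompatibility,
    _Goal.stub_compatibilityAwayFromLR, _Goal.stub_canonicalReciprocityData] at hXB hW hP hA hRD
  -- U (stub 6) is a theorem of the tree (lead, cycle 1; p172889): used directly, no longer a hypothesis
  have hU := stub_avatarConjugacy
  rw [sectorComplement_iff]
  intro hX F _ _
  -- B_w (Fontaine–Mazur–Langlands, a.e. form, every K and n) from the route TARGET (the Borel–FL sector) and the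
  -- first stub (B_w granted the sector): the crux's hypothesis is CONSUMED here, not discarded
  have hB := hXB hX
  refine ⟨hRD F, fun Rec n hn hcpt => ?_⟩
  -- every finite place misses the prime 2 or the prime 3
  have hprime : ∀ v : IsDedekindDomain.HeightOneSpectrum (NumberField.RingOfIntegers F),
      ∃ (ℓ' : ℕ) (_ : Fact ℓ'.Prime), ((ℓ' : ℕ) : NumberField.RingOfIntegers F) ∉ v.asIdeal := by
    intro v
    by_cases h2 : ((2 : ℕ) : NumberField.RingOfIntegers F) ∈ v.asIdeal
    · refine ⟨3, ⟨Nat.prime_three⟩, fun h3 => v.isPrime.ne_top ((Ideal.eq_top_iff_one _).2 ?_)⟩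
      have h := v.asIdeal.sub_mem h3 h2
      have h1 : ((3 : ℕ) : NumberField.RingOfIntegers F) - ((2 : ℕ) : NumberField.RingOfIntegers F) = 1 := by
        push_cast; norm_num
      rwa [h1] at h
    · exact ⟨2, ⟨Nat.prime_two⟩, h2⟩
  -- the local–global helper for the datum `Rec` at hand: geometric + compatible at EVERY finite place, for
  -- irreducible Satake–Frobenius compatible pairs; above ℓ the place is read through a prime below it (P(ii), the
  -- prime switch) applied to an ℓ'-adic avatar from W⁺, ℓ' ∈ {2, 3}
  have hLGC : ∀ (π : Literature.NumberTheory.Automorphic.CuspidalAutomorphicRepData n F hcpt), π.1.IsLAlgebraic →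
      ∀ (ℓ : ℕ) [Fact ℓ.Prime] (ι : PadicAlgCl ℓ ≃+* ℂ)
        (ρ : Literature.NumberTheory.GaloisRepresentations.FramedGaloisRep F (PadicAlgCl ℓ) n),
        ρ.toGaloisRep.IsIrreducible →
        (∀ᶠ v : IsDedekindDomain.HeightOneSpectrum (NumberField.RingOfIntegers F) in cofinite,
          SatakeFrobCompatibleAt ι π.1 ρ v) →
        IsGeometricFramed Rec ρ ∧
          ∀ v : IsDedekindDomain.HeightOneSpectrum (NumberField.RingOfIntegers F),
            LocalGlobalCompatibleAt Rec ι π.1 ρ v := by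
    intro π hL ℓ _ ι ρ hirr hρ
    have hgeo : (∀ᶠ v : IsDedekindDomain.HeightOneSpectrum (NumberField.RingOfIntegers F) in cofinite,
        ρ.IsUnramifiedAt v) ∧
        ∀ (v : IsDedekindDomain.HeightOneSpectrum (NumberField.RingOfIntegers F))
          (hv : ((ℓ : ℕ) : NumberField.RingOfIntegers F) ∈ v.asIdeal),
          (Literature.NumberTheory.PAdicHodge.fontainePstAdicCompletion v ℓ hv).IsDeRhamFramed
            (ρ.toLocal v) :=
      ⟨hρ.mono fun v ⟨_, _, hur, _⟩ => hur, fun v hv => (hP F n hcpt hn π hL ℓ ι ρ hirr hρ v hv).1⟩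
    refine ⟨hgeo, fun v => ?_⟩
    by_cases hv : ((ℓ : ℕ) : NumberField.RingOfIntegers F) ∈ v.asIdeal
    · obtain ⟨ℓ', _, hℓ'⟩ := hprime v
      obtain ⟨ι'⟩ := PadicAlgCl.nonempty_ringEquiv_complex ℓ'
      obtain ⟨ρ', hirr', hρ'⟩ := hW F n hcpt hn π hL ℓ' ι'
      have hgeo' : (∀ᶠ w : IsDedekindDomain.HeightOneSpectrum (NumberField.RingOfIntegers F) in cofinite,
          ρ'.IsUnramifiedAt w) ∧
          ∀ (w : IsDedekindDomain.HeightOneSpectrum (NumberField.RingOfIntegers F))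
            (hw : ((ℓ' : ℕ) : NumberField.RingOfIntegers F) ∈ w.asIdeal),
            (Literature.NumberTheory.PAdicHodge.fontainePstAdicCompletion w ℓ' hw).IsDeRhamFramed
              (ρ'.toLocal w) :=
        ⟨hρ'.mono fun w ⟨_, _, hur, _⟩ => hur,
          fun w hw => (hP F n hcpt hn π hL ℓ' ι' ρ' hirr' hρ' w hw).1⟩
      exact (hP F n hcpt hn π hL ℓ ι ρ hirr hρ v hv).2 Rec ℓ' ι' ρ' hℓ' hirr' hρ'
        (hA F Rec n hcpt hn π hL ℓ' ι' ρ' hirr' hgeo' hρ' v hℓ')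
    · exact hA F Rec n hcpt hn π hL ℓ ι ρ hirr hgeo hρ v hv
  refine ⟨?_, ?_⟩
  · -- (A) automorphic → Galois, with uniqueness up to conjugacy from U
    intro π hL ℓ _ ι
    obtain ⟨ρ, hirr, hρ⟩ := hW F n hcpt hn π hL ℓ ι
    obtain ⟨hgeo, hloc⟩ := hLGC π hL ℓ ι ρ hirr hρ
    exact ⟨ρ, hirr, hgeo, ⟨hρ, hloc⟩, fun ρ' h' => hU F n hcpt π ℓ ι ρ ρ' hirr hρ h'.1⟩
  · -- (B) Galois → automorphic: B_w (granted the sector) + the helper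
    intro ℓ _ ι ρ hirr hgeo
    obtain ⟨π, hL, hρ⟩ := hB F n hcpt hn ℓ ι ρ hirr hgeo
    exact ⟨π, hL, hρ, (hLGC π hL ℓ ι ρ hirr hρ).2⟩

/-- By-name sanity check (an `example`, not a declaration): the five open stubs feed the composition as they stand. -/
example : SectorComplement :=
  SectorComplement_of stub_weakAutomorphyFromBorelFL stub_satakeAvatarExistence stub_padicMemberCompatibility
    stub_compatibilityAwayFromLR stub_canonicalReciprocityData

end Summit.Langlands.Langlands.Cruxes.SectorComplement.BirthEisensteinDegreeShift

end
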